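import Summits.BirchSwinnertonDyer.BirchSwinnertonDyer.Theses.BiquadraticEisensteinDescent
import Summits.BirchSwinnertonDyer.BirchSwinnertonDyer.Theorems.BiquadraticEisensteinDescentHeegnerFieldSupplyEvenRung
import HarnessLib

/-!
# `BiquadraticEisensteinDescent.HeegnerClassNumberSupplyCMInertBadOfBRR` holds (route BiquadraticEisensteinDescent, W-ALL
# row 12 · K12i; item stmt-BirchSwinnertonDyer-21380 = the CLASS-NUMBER-SUPPLY child of the split of the K′-supply crux
# KS_R `HeegnerFieldSupplyCMInertBadKPrime` (stmt-20713), route author bsd-wall-cm g11, rev 23+)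

The child decl `HeegnerClassNumberSupplyCMInertBadOfBRR := Literature.NumberTheory.QuadraticFields.BRR2022_thm_1 →
<the registered stub_KSR1 verbatim: for every (W, p) of the CM inert-bad corner and every bound B an imaginary quadratic K′
with B < |d_K′|, 4 < |d_K′|, the Heegner hypothesis for N_W and p ∤ h(K′)>` is, textually, the statement of the tree theorem
`…Theorems.BiquadraticEisensteinDescentHeegnerFieldSupplyEvenRung.ksr1_of_brr2022` (p555038, prover seat bsd-wall-bed-p2 g7:
the «2-split seed» BRR⁺ from Beckwith–Raum–Richter Adv. Math. 2022 Thm. 1 — sieve of the Hurwitz class numbers to the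
progression `8p∏S·ℤ − 1`, Cox Thm. 7.24, the decomposition law; EVERY conductor, the prime `2` included). So the item
closes by ONE `exact`.

HONEST FRAMING: THEOREMS ONLY (0 definitions, 0 named facts, 0 `sorry`). The decl is an IMPLICATION whose antecedent is
the published input BRR 2022 Thm. 1 (route item `BeckwithRaumRichterResidueInput`, by name); proving it asserts nothing about
that input. BSD is not proved by this file. Prover seat bsd-wall-bed-p2 (g7), 2026-08-27.
References: [BeckwithRaumRichter2022] Adv. Math. 409 (2022) 108663, Thm. 1; [Cox2013] Thm. 7.24, Thm. 7.7(ii).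
-/

set_option autoImplicit false

-- D-0017 layout: summit = sub-problem, so `Summit.BirchSwinnertonDyer.BirchSwinnertonDyer.…` is the mandated namespace.
set_option linter.dupNamespace false

namespace Summit.BirchSwinnertonDyer.BirchSwinnertonDyer.Theorems.BiquadraticEisensteinDescentHeegnerClassNumberSupplyCMInertBadOfBRR

/-- **The class-number-supply child `HeegnerClassNumberSupplyCMInertBadOfBRR` holds**: granted BRR 2022 Thm. 1, for `W`
CM of analytic rank one, `p ≥ 5` inert-bad and every bound `B`, an imaginary quadratic `K′` with `B < |d_K′|`,
`4 < |d_K′|`, the Heegner hypothesis for `N_W` (every conductor, `2 ∣ N_W` included) and `p ∤ h(K′)`. Proof: the tree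
theorem `…HeegnerFieldSupplyEvenRung.ksr1_of_brr2022` (p555038) has exactly this type.
[cite: BeckwithRaumRichter2022, Theorem 1] [cite: Cox2013, §7.D Thm. 7.24] -/
theorem heegnerClassNumberSupplyCMInertBadOfBRR_proof :
    Summit.BirchSwinnertonDyer.BirchSwinnertonDyer.Theses.BiquadraticEisensteinDescent.HeegnerClassNumberSupplyCMInertBadOfBRR :=
  Summit.BirchSwinnertonDyer.BirchSwinnertonDyer.Theorems.BiquadraticEisensteinDescentHeegnerFieldSupplyEvenRung.ksr1_of_brr2022

end Summit.BirchSwinnertonDyer.BirchSwinnertonDyer.Theorems.BiquadraticEisensteinDescentHeegnerClassNumberSupplyCMInertBadOfBRR
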